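import Summits.RiemannHypothesis.RiemannHypothesis.Theorems.PfPersistenceBottomVectors
import Summits.RiemannHypothesis.RiemannHypothesis.Theorems.PfPersistenceScaleInvariance
import HarnessLib

/-!
# PF persistence — bottom EIGENSPACES: a gap that always exists, the orthogonal foot, the space tolerance, and
the eigenspace Davis–Kahan lemma (pub-rhpf, barrier-prover gen 4; file 1 of 2 of the binder-free eigenvector wall)

**HONEST FRAMING. This is a long-odds MECHANISM SEARCH; no RH claims.** Everything in this file is RH-free,
finite-dimensional linear algebra about real matrices `Matrix (Fin n) (Fin n) ℝ`, their bottom Rayleigh value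
`bottomRayleigh` (`ε₁`) and bottom vectors `IsBottomVector`. Nothing here bears on the truth of RH. Labels: every
statement below is PROVED; no DATA.

WHY. The gen-3 eigenvector-tolerance wall (`PfPersistenceEigenvectorTolerance`) carries at each window the NUMERICAL
BINDER `HasBottomGap (zetaDatum (W i)) (U₀ i) (γ i)` — a certified SIMPLE bottom with a variational gap; no such
certificate exists in the tree for any window (leaf G1.22ev: 'closed-by-theorem MODULO per-window binders', RULINGS
A186 / A195). The companion file `PfPersistenceEigenspaceTolerance` removes the binder for the tolerance face; this
file supplies the linear algebra:

* §1 the bottom EIGENSPACE `bottomSpace M` (a `Submodule`; `IsBottomVector M u ↔ u ≠ 0 ∧ u ∈ bottomSpace M`),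
  closed and scale-invariant.
* §2 **A GAP ALWAYS EXISTS** (`exists_spaceGap_of_isSymm`): for EVERY real symmetric matrix there is `γ > 0` with
  `(ε₁ + γ)|v|² ≤ vᵀMv` on the dot-orthocomplement of the bottom eigenspace (`SpaceGap M γ`) — compactness of the
  unit sphere ∩ orthocomplement plus 'Rayleigh minimisers are bottom vectors' (`isBottomVector_of_form_eq`). Unlike
  `HasBottomGap` this asks nothing of the bottom's multiplicity.
* §3 the ORTHOGONAL FOOT `u = e + v`, `e ∈ E`, `v ⊥ E`, onto any closed submodule of `Fin n → ℝ` (compactness + the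
  first-order condition; division-free; no inner-product-space instance is put on `Fin n → ℝ`).
* §4 the SPACE TOLERANCE `NearSpace τ u E` (`∃ e ∈ E, |u − e|² ≤ τ|u|²`, i.e. `sin² ∠(u, E) ≤ τ`; scale-free and
  sign-blind in `u`) and its agreement with the gen-3 cone `SinSqLe τ u u₀` when `E = ℝu₀`
  (`nearSpace_span_iff_sinSqLe`).
* §5 **EIGENSPACE DAVIS–KAHAN** (`nearSpace_bottomSpace_of_isBottomVector`): `M₀` symmetric with `SpaceGap M₀ γ`,
  `M` form-close (`|vᵀ(M₀ − M)v| ≤ ε|v|²`) ⇒ EVERY bottom vector of `M` is `NearSpace (2ε/γ)`-close to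
  `bottomSpace M₀` (no symmetry of `M`, no simplicity of any bottom).
-/

set_option linter.dupNamespace false  -- the mandated namespace repeats `RiemannHypothesis`

noncomputable section

open Real Finset Matrix Set

namespace Summit.RiemannHypothesis.RiemannHypothesis.Theorems.PfPersistence

/-! ## §1 The bottom eigenspace -/

/-- THE BOTTOM EIGENSPACE of a window matrix: `{u | Mu = ε₁ u}` as a submodule of `Fin n → ℝ` (it is `{0}` exactly
when `M` has no bottom vector; for symmetric `M` in positive dimension it is non-trivial,
`exists_isBottomVector_of_isSymm`). [folklore] -/
def bottomSpace {n : ℕ} (M : Matrix (Fin n) (Fin n) ℝ) : Submodule ℝ (Fin n → ℝ) where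
  carrier := {u | M *ᵥ u = bottomRayleigh M • u}
  add_mem' := by
    intro a b ha hb
    simp only [mem_setOf_eq] at ha hb ⊢
    rw [mulVec_add, ha, hb, smul_add]
  zero_mem' := by simp
  smul_mem' := by
    intro c u hu
    simp only [mem_setOf_eq] at hu ⊢
    rw [mulVec_smul, hu, smul_smul, smul_smul, mul_comm]

/-- PROVED: membership in the bottom eigenspace is the eigen-equation. [folklore] -/
theorem mem_bottomSpace {n : ℕ} {M : Matrix (Fin n) (Fin n) ℝ} {u : Fin n → ℝ} :
    u ∈ bottomSpace M ↔ M *ᵥ u = bottomRayleigh M • u := Iff.rfl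

/-- PROVED: a bottom vector is a nonzero member of the bottom eigenspace. [folklore] -/
theorem isBottomVector_iff_mem_bottomSpace {n : ℕ} {M : Matrix (Fin n) (Fin n) ℝ} {u : Fin n → ℝ} :
    IsBottomVector M u ↔ u ≠ 0 ∧ u ∈ bottomSpace M := Iff.rfl

/-- PROVED: the bottom eigenspace is closed. [folklore] -/
theorem isClosed_bottomSpace {n : ℕ} (M : Matrix (Fin n) (Fin n) ℝ) :
    IsClosed (bottomSpace M : Set (Fin n → ℝ)) := by
  change IsClosed {u : Fin n → ℝ | M *ᵥ u = bottomRayleigh M • u}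
  exact isClosed_eq (f := fun u : Fin n → ℝ => M *ᵥ u) (g := fun u : Fin n → ℝ => bottomRayleigh M • u)
    (continuous_const.matrix_mulVec continuous_id) (continuous_const_smul (bottomRayleigh M))

/-- PROVED: the bottom eigenspace is SCALE-INVARIANT (`c > 0`). [folklore] -/
theorem bottomSpace_smul {n : ℕ} {c : ℝ} (hc : 0 < c) (M : Matrix (Fin n) (Fin n) ℝ) :
    bottomSpace (c • M) = bottomSpace M := by
  ext u
  by_cases hu : u = 0
  · subst hu
    exact ⟨fun _ => Submodule.zero_mem _, fun _ => Submodule.zero_mem _⟩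
  · have h := isBottomVector_smul_iff hc M u
    simp only [IsBottomVector, ne_eq, hu, not_false_eq_true, true_and] at h
    exact h

/-! ## §2 A gap above the bottom eigenspace ALWAYS exists (symmetric matrices) -/

/-- THE SPACE GAP `SpaceGap M γ`: `γ > 0` and `(ε₁ + γ)|v|² ≤ vᵀMv` for every `v` dot-orthogonal to the bottom
eigenspace. Unlike `HasBottomGap` (which names ONE bottom vector and so forces a simple bottom) this asks nothing
of the bottom's multiplicity. [folklore] -/
def SpaceGap {n : ℕ} (M : Matrix (Fin n) (Fin n) ℝ) (γ : ℝ) : Prop :=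
  0 < γ ∧ ∀ v : Fin n → ℝ, (∀ e ∈ bottomSpace M, v ⬝ᵥ e = 0) → (bottomRayleigh M + γ) * (v ⬝ᵥ v) ≤ v ⬝ᵥ (M *ᵥ v)

/-- **PROVED — A SPACE GAP EXISTS FOR EVERY REAL SYMMETRIC MATRIX** (no hypothesis on the spectrum). Proof: the
unit sphere intersected with the orthocomplement `K` is compact; if it is empty any `γ` works vacuously (after
normalisation); otherwise the form attains a minimum `m` on `K`, and `m = ε₁` is impossible because a Rayleigh
minimiser is a bottom vector (`isBottomVector_of_form_eq`), hence in the eigenspace, hence orthogonal to itself;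
take `γ := m − ε₁`. [folklore] -/
theorem exists_spaceGap_of_isSymm {n : ℕ} {M : Matrix (Fin n) (Fin n) ℝ} (hM : M.IsSymm) :
    ∃ γ : ℝ, SpaceGap M γ := by
  set K : Set (Fin n → ℝ) :=
    {v : Fin n → ℝ | v ⬝ᵥ v = 1} ∩ {v | ∀ e ∈ bottomSpace M, v ⬝ᵥ e = 0} with hK
  have hKc : IsCompact K := by
    have h2 : IsClosed {v : Fin n → ℝ | ∀ e ∈ bottomSpace M, v ⬝ᵥ e = 0} := by
      have e1 : {v : Fin n → ℝ | ∀ e ∈ bottomSpace M, v ⬝ᵥ e = 0} =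
          ⋂ e ∈ (bottomSpace M : Set (Fin n → ℝ)), {v | v ⬝ᵥ e = 0} := by
        ext v
        simp only [mem_setOf_eq, mem_iInter, SetLike.mem_coe]
      rw [e1]
      exact isClosed_biInter fun e _ => isClosed_eq (continuous_id.dotProduct continuous_const) continuous_const
    exact (isCompact_dotSelf_eq_one n).inter_right h2
  -- normalisation of a nonzero vector of the orthocomplement into `K`
  have hnorm : ∀ v : Fin n → ℝ, v ≠ 0 → (∀ e ∈ bottomSpace M, v ⬝ᵥ e = 0) →
      ((Real.sqrt (v ⬝ᵥ v))⁻¹ • v) ∈ K ∧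
        ((Real.sqrt (v ⬝ᵥ v))⁻¹ • v) ⬝ᵥ (M *ᵥ ((Real.sqrt (v ⬝ᵥ v))⁻¹ • v)) =
          (v ⬝ᵥ v)⁻¹ * (v ⬝ᵥ (M *ᵥ v)) := by
    intro v hv hvE
    have hs : 0 < v ⬝ᵥ v := dotSelf_pos_of_ne_zero hv
    have hc2 : (Real.sqrt (v ⬝ᵥ v))⁻¹ * (Real.sqrt (v ⬝ᵥ v))⁻¹ = (v ⬝ᵥ v)⁻¹ := by
      rw [← mul_inv, Real.mul_self_sqrt hs.le]
    refine ⟨⟨?_, fun e he => ?_⟩, ?_⟩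
    · show ((Real.sqrt (v ⬝ᵥ v))⁻¹ • v) ⬝ᵥ ((Real.sqrt (v ⬝ᵥ v))⁻¹ • v) = 1
      rw [smul_dotProduct, dotProduct_smul, smul_eq_mul, smul_eq_mul, ← mul_assoc, hc2, inv_mul_cancel₀ hs.ne']
    · rw [smul_dotProduct, smul_eq_mul, hvE e he, mul_zero]
    · rw [mulVec_smul, dotProduct_smul, smul_dotProduct, smul_eq_mul, smul_eq_mul, ← mul_assoc, hc2]
  by_cases hne : K.Nonempty
  · have hc : Continuous fun v : Fin n → ℝ => v ⬝ᵥ (M *ᵥ v) :=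
      continuous_id.dotProduct (continuous_const.matrix_mulVec continuous_id)
    obtain ⟨u, huK, hmin⟩ := hKc.exists_isMinOn hne hc.continuousOn
    rw [isMinOn_iff] at hmin
    obtain ⟨hu1, huE⟩ := huK
    simp only [mem_setOf_eq] at hu1 huE
    have hu0 : u ≠ 0 := fun h => by simp [h] at hu1
    -- the minimum value exceeds `ε₁`
    have hm : bottomRayleigh M < u ⬝ᵥ (M *ᵥ u) := by
      have hle : bottomRayleigh M * (u ⬝ᵥ u) ≤ u ⬝ᵥ (M *ᵥ u) := bottomRayleigh_mul_le_form M u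
      rw [hu1, mul_one] at hle
      refine lt_of_le_of_ne hle fun heq => ?_
      have hbv : IsBottomVector M u := isBottomVector_of_form_eq hM hu0 (by rw [hu1, mul_one]; exact heq.symm)
      have h0 : u ⬝ᵥ u = 0 := huE u hbv.2
      rw [hu1] at h0
      exact one_ne_zero h0
    refine ⟨u ⬝ᵥ (M *ᵥ u) - bottomRayleigh M, sub_pos.2 hm, fun v hvE => ?_⟩
    have e0 : bottomRayleigh M + (u ⬝ᵥ (M *ᵥ u) - bottomRayleigh M) = u ⬝ᵥ (M *ᵥ u) := by ring
    rw [e0]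
    by_cases hv : v = 0
    · subst hv
      simp
    obtain ⟨hvK, hval⟩ := hnorm v hv hvE
    have h := hmin _ hvK
    rw [hval] at h
    have hs : 0 < v ⬝ᵥ v := dotSelf_pos_of_ne_zero hv
    rw [← div_eq_inv_mul, le_div_iff₀ hs] at h
    exact h
  · refine ⟨1, one_pos, fun v hvE => ?_⟩
    by_cases hv : v = 0
    · subst hv
      simp
    exact absurd ⟨_, (hnorm v hv hvE).1⟩ hne

/-! ## §3 The nearest-point decomposition onto a closed submodule -/

/-- **PROVED — ORTHOGONAL FOOT.** For a closed submodule `E` of `Fin n → ℝ` and any `u` there is `e ∈ E` with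
`u − e` dot-orthogonal to `E`. Proof: minimise `|u − e|²` over the compact set `E ∩ {|u − e|² ≤ |u|²}` (closed, and
sup-norm bounded by `1 + |u|²` coordinatewise); the minimiser is global on `E`; the first-order condition along
`e + t e'` is a discriminant. [folklore] -/
theorem exists_orthogonal_foot {n : ℕ} (E : Submodule ℝ (Fin n → ℝ)) (hE : IsClosed (E : Set (Fin n → ℝ)))
    (u : Fin n → ℝ) : ∃ e ∈ E, ∀ e' ∈ E, (u - e) ⬝ᵥ e' = 0 := by
  set K : Set (Fin n → ℝ) := (E : Set (Fin n → ℝ)) ∩ {e | (u - e) ⬝ᵥ (u - e) ≤ u ⬝ᵥ u} with hK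
  have hg : Continuous fun e : Fin n → ℝ => (u - e) ⬝ᵥ (u - e) :=
    (continuous_const.sub continuous_id).dotProduct (continuous_const.sub continuous_id)
  have hq : 0 ≤ u ⬝ᵥ u := dotProduct_self_nonneg_real u
  have hKc : IsCompact K := by
    refine (isCompact_closedBall (0 : Fin n → ℝ) (1 + u ⬝ᵥ u)).of_isClosed_subset
      (hE.inter (isClosed_le hg continuous_const)) ?_
    rintro e ⟨-, he⟩
    simp only [mem_setOf_eq] at he
    rw [Metric.mem_closedBall, dist_zero_right, pi_norm_le_iff_of_nonneg (by linarith)]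
    intro i
    rw [Real.norm_eq_abs, abs_le]
    have h1 : (u - e) i ^ 2 ≤ (u - e) ⬝ᵥ (u - e) := coord_sq_le_dotSelf (u - e) i
    have h2 : u i ^ 2 ≤ u ⬝ᵥ u := coord_sq_le_dotSelf u i
    rw [Pi.sub_apply] at h1
    constructor <;> nlinarith [h1, h2, he, sq_nonneg (u i - 1), sq_nonneg (u i + 1),
      sq_nonneg (u i - e i - 1), sq_nonneg (u i - e i + 1)]
  have h0K : (0 : Fin n → ℝ) ∈ K := ⟨E.zero_mem, by simp⟩
  obtain ⟨e, heK, hmin⟩ := hKc.exists_isMinOn ⟨0, h0K⟩ hg.continuousOn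
  rw [isMinOn_iff] at hmin
  obtain ⟨heE, -⟩ := heK
  have heE' : e ∈ E := heE
  -- `e` minimises `|u − e'|²` over ALL of `E`
  have hglob : ∀ e' ∈ E, (u - e) ⬝ᵥ (u - e) ≤ (u - e') ⬝ᵥ (u - e') := by
    intro e' he'
    by_cases hK' : (u - e') ⬝ᵥ (u - e') ≤ u ⬝ᵥ u
    · exact hmin e' ⟨he', hK'⟩
    · have h0 := hmin 0 h0K
      simp only [sub_zero] at h0
      linarith [lt_of_not_ge hK']
  refine ⟨e, heE', fun e' he' => ?_⟩
  -- first-order condition along `e + t e'`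
  have key : ∀ t : ℝ, 0 ≤ (e' ⬝ᵥ e') * (t * t) + (-(2 * (e' ⬝ᵥ (u - e)))) * t + 0 := by
    intro t
    have hmem : e + t • e' ∈ E := E.add_mem heE' (E.smul_mem t he')
    have h := hglob _ hmem
    have hexp : u - (e + t • e') = (u - e) + (-t) • e' := by
      ext i
      simp only [Pi.sub_apply, Pi.add_apply, Pi.smul_apply, smul_eq_mul]
      ring
    rw [hexp, dotProduct_add_smul_self] at h
    nlinarith [h]
  have hd := discrim_le_zero key
  rw [discrim] at hd
  have hsq : (e' ⬝ᵥ (u - e)) ^ 2 = 0 := le_antisymm (by nlinarith [hd]) (sq_nonneg _)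
  rw [dotProduct_comm]
  exact (pow_eq_zero_iff two_ne_zero).1 hsq

/-! ## §4 The space tolerance and its agreement with the gen-3 cone on a line -/

/-- THE SPACE TOLERANCE `NearSpace τ u E`: some `e ∈ E` has `|u − e|² ≤ τ |u|²`, i.e. `sin² ∠(u, E) ≤ τ` — the
scale-free, sign-blind closeness of a direction to a SUBSPACE (the right tolerance at a degenerate bottom, where no
single reference vector exists). [folklore] -/
def NearSpace {n : ℕ} (τ : ℝ) (u : Fin n → ℝ) (E : Submodule ℝ (Fin n → ℝ)) : Prop :=
  ∃ e ∈ E, (u - e) ⬝ᵥ (u - e) ≤ τ * (u ⬝ᵥ u)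

/-- PROVED: monotone in `τ`. [folklore] -/
theorem NearSpace.mono {n : ℕ} {τ τ' : ℝ} {u : Fin n → ℝ} {E : Submodule ℝ (Fin n → ℝ)} (h : NearSpace τ u E)
    (hτ : τ ≤ τ') : NearSpace τ' u E := by
  obtain ⟨e, he, h⟩ := h
  exact ⟨e, he, h.trans (mul_le_mul_of_nonneg_right hτ (dotProduct_self_nonneg_real u))⟩

/-- PROVED: monotone in the subspace. [folklore] -/
theorem NearSpace.mono_right {n : ℕ} {τ : ℝ} {u : Fin n → ℝ} {E E' : Submodule ℝ (Fin n → ℝ)}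
    (h : NearSpace τ u E) (hEE' : E ≤ E') : NearSpace τ u E' := by
  obtain ⟨e, he, h⟩ := h
  exact ⟨e, hEE' he, h⟩

/-- PROVED: members are `0`-close. [folklore] -/
theorem nearSpace_zero_of_mem {n : ℕ} {u : Fin n → ℝ} {E : Submodule ℝ (Fin n → ℝ)} (hu : u ∈ E) :
    NearSpace 0 u E :=
  ⟨u, hu, by simp⟩

/-- PROVED: SCALE-FREE in `u`. [folklore] -/
theorem NearSpace.smul_left {n : ℕ} {τ : ℝ} {u : Fin n → ℝ} {E : Submodule ℝ (Fin n → ℝ)} (h : NearSpace τ u E)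
    (c : ℝ) : NearSpace τ (c • u) E := by
  obtain ⟨e, he, h⟩ := h
  refine ⟨c • e, E.smul_mem c he, ?_⟩
  rw [← smul_sub, smul_dotProduct, dotProduct_smul, smul_dotProduct, dotProduct_smul]
  simp only [smul_eq_mul]
  have e1 : τ * (c * (c * (u ⬝ᵥ u))) = c * c * (τ * (u ⬝ᵥ u)) := by ring
  rw [← mul_assoc, e1]
  exact mul_le_mul_of_nonneg_left h (mul_self_nonneg c)

/-- PROVED: SIGN-BLIND in `u`. [folklore] -/
theorem NearSpace.neg_left {n : ℕ} {τ : ℝ} {u : Fin n → ℝ} {E : Submodule ℝ (Fin n → ℝ)} (h : NearSpace τ u E) :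
    NearSpace τ (-u) E := by
  have h' := h.smul_left (-1)
  rwa [neg_one_smul] at h'

/-- PROVED: in the `0`-cone of a nonzero `u₀` a vector is PARALLEL to `u₀`. [folklore] -/
theorem eq_smul_of_sinSqLe_zero {n : ℕ} {u u₀ : Fin n → ℝ} (hu₀ : u₀ ≠ 0) (h : SinSqLe 0 u u₀) :
    ∃ c : ℝ, u = c • u₀ := by
  have hs : u₀ ⬝ᵥ u₀ ≠ 0 := (dotSelf_pos_of_ne_zero hu₀).ne'
  have hw : orthPart u u₀ ⬝ᵥ orthPart u u₀ ≤ 0 := by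
    have := orthPart_dotSelf_le_of_sinSqLe h
    rwa [zero_mul] at this
  have hw0 : orthPart u u₀ = 0 :=
    dotProduct_self_eq_zero.1 (le_antisymm hw (dotProduct_self_nonneg_real _))
  have hdec := smul_eq_orthPart_add u u₀
  rw [hw0, zero_add] at hdec
  have h2 := congrArg (fun x => (u₀ ⬝ᵥ u₀)⁻¹ • x) hdec
  simp only [smul_smul, inv_mul_cancel₀ hs, one_smul] at h2
  exact ⟨_, h2⟩

/-- **PROVED — ON A LINE THE SPACE TOLERANCE IS THE GEN-3 CONE**: for `u₀ ≠ 0`,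
`NearSpace τ u (ℝ u₀) ↔ SinSqLe τ u u₀` (both say `sin² ∠(u, ±u₀) ≤ τ`; the identity
`|u₀|²|u − c u₀|² = (|u|²|u₀|² − (u·u₀)²) + (c|u₀|² − u·u₀)²`). [folklore] -/
theorem nearSpace_span_iff_sinSqLe {n : ℕ} {τ : ℝ} {u u₀ : Fin n → ℝ} (hu₀ : u₀ ≠ 0) :
    NearSpace τ u (Submodule.span ℝ {u₀}) ↔ SinSqLe τ u u₀ := by
  have hs : 0 < u₀ ⬝ᵥ u₀ := dotSelf_pos_of_ne_zero hu₀
  have hexp : ∀ c : ℝ, (u - c • u₀) ⬝ᵥ (u - c • u₀) =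
      u ⬝ᵥ u - 2 * c * (u ⬝ᵥ u₀) + c * c * (u₀ ⬝ᵥ u₀) := by
    intro c
    simp only [sub_dotProduct, dotProduct_sub, smul_dotProduct, dotProduct_smul, smul_eq_mul, dotProduct_comm u₀ u]
    ring
  constructor
  · rintro ⟨e, he, h⟩
    obtain ⟨c, rfl⟩ := Submodule.mem_span_singleton.1 he
    rw [hexp] at h
    unfold SinSqLe
    nlinarith [h, mul_le_mul_of_nonneg_left h hs.le, sq_nonneg (c * (u₀ ⬝ᵥ u₀) - u ⬝ᵥ u₀),
      dotProduct_self_nonneg_real u]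
  · intro h
    refine ⟨((u ⬝ᵥ u₀) / (u₀ ⬝ᵥ u₀)) • u₀, Submodule.mem_span_singleton.2 ⟨_, rfl⟩, ?_⟩
    rw [hexp]
    have hc : (u ⬝ᵥ u₀) / (u₀ ⬝ᵥ u₀) * (u₀ ⬝ᵥ u₀) = u ⬝ᵥ u₀ := div_mul_cancel₀ _ hs.ne'
    unfold SinSqLe at h
    refine le_of_mul_le_mul_left ?_ hs
    have e1 : (u₀ ⬝ᵥ u₀) * (u ⬝ᵥ u - 2 * ((u ⬝ᵥ u₀) / (u₀ ⬝ᵥ u₀)) * (u ⬝ᵥ u₀) +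
        (u ⬝ᵥ u₀) / (u₀ ⬝ᵥ u₀) * ((u ⬝ᵥ u₀) / (u₀ ⬝ᵥ u₀)) * (u₀ ⬝ᵥ u₀)) =
        (u ⬝ᵥ u) * (u₀ ⬝ᵥ u₀) - (u ⬝ᵥ u₀) ^ 2 := by
      linear_combination ((u ⬝ᵥ u₀) / (u₀ ⬝ᵥ u₀) * (u₀ ⬝ᵥ u₀) - 2 * (u ⬝ᵥ u₀) + (u ⬝ᵥ u₀)) * hc
    rw [e1]
    nlinarith [h]

/-! ## §5 The eigenspace DAVIS–KAHAN lemma -/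

/-- **PROVED — EIGENSPACE DAVIS–KAHAN.** Let `M₀` be symmetric (positive dimension) with `SpaceGap M₀ γ` and let `M`
be form-close to it, `|vᵀ(M₀ − M)v| ≤ ε|v|²`. Then EVERY bottom vector `u` of `M` is `NearSpace (2ε/γ)`-close to
`bottomSpace M₀`. Proof: `ε₁(M) ≤ ε₁(M₀) + ε` (test a bottom vector of `M₀`), so `uᵀM₀u ≤ (ε₁(M₀) + 2ε)|u|²`; with
the orthogonal foot `u = e + v`, `e ∈ E`, `v ⊥ E`: `uᵀM₀u = vᵀM₀v + ε₁(M₀)|e|² ≥ ε₁(M₀)|u|² + γ|v|²`; compare.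
No symmetry of `M`, no simplicity of any bottom. [folklore] -/
theorem nearSpace_bottomSpace_of_isBottomVector {n : ℕ} {M₀ M : Matrix (Fin (n + 1)) (Fin (n + 1)) ℝ}
    (hM₀ : M₀.IsSymm) {γ ε : ℝ} (hgap : SpaceGap M₀ γ)
    (hclose : ∀ v : Fin (n + 1) → ℝ, |v ⬝ᵥ ((M₀ - M) *ᵥ v)| ≤ ε * (v ⬝ᵥ v))
    {u : Fin (n + 1) → ℝ} (hu : IsBottomVector M u) : NearSpace (2 * ε / γ) u (bottomSpace M₀) := by
  obtain ⟨hγ, hgap'⟩ := hgap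
  -- (1) `ε₁(M) ≤ ε₁(M₀) + ε`, testing a bottom vector of `M₀`
  obtain ⟨u₀, hu₀, -⟩ := exists_isBottomVector_of_isSymm hM₀
  have hs : 0 < u₀ ⬝ᵥ u₀ := dotSelf_pos_of_ne_zero hu₀.1
  have h1 : bottomRayleigh M ≤ bottomRayleigh M₀ + ε := by
    have ha := bottomRayleigh_mul_le_form M u₀
    have hb := hclose u₀
    rw [sub_mulVec, dotProduct_sub, form_eq_of_isBottomVector hu₀] at hb
    have hb' := (abs_le.1 hb).1
    refine le_of_mul_le_mul_right ?_ hs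
    linarith
  -- (2) the form of `M₀` at `u` from above
  have h2 : u ⬝ᵥ (M₀ *ᵥ u) ≤ (bottomRayleigh M₀ + 2 * ε) * (u ⬝ᵥ u) := by
    have hb := (abs_le.1 (hclose u)).2
    rw [sub_mulVec, dotProduct_sub, form_eq_of_isBottomVector hu] at hb
    have hq := dotProduct_self_nonneg_real u
    have := mul_le_mul_of_nonneg_right h1 hq
    linarith
  -- (3) the orthogonal foot `e` of `u` on `E := bottomSpace M₀`, `v := u − e`
  obtain ⟨e, he, hv⟩ := exists_orthogonal_foot (bottomSpace M₀) (isClosed_bottomSpace M₀) u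
  have heq : M₀ *ᵥ e = bottomRayleigh M₀ • e := he
  obtain ⟨v, hv_def⟩ : ∃ v : Fin (n + 1) → ℝ, v = u - e := ⟨_, rfl⟩
  have hu_dec : u = v + (1 : ℝ) • e := by rw [hv_def, one_smul, sub_add_cancel]
  have hve : e ⬝ᵥ v = 0 := by rw [dotProduct_comm, hv_def]; exact hv e he
  have hcross : e ⬝ᵥ (M₀ *ᵥ v) = 0 := by
    have hc : e ⬝ᵥ (M₀ *ᵥ v) = v ⬝ᵥ (M₀ *ᵥ e) := by
      rw [dotProduct_mulVec, ← mulVec_transpose, hM₀.eq, dotProduct_comm]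
    rw [hc, heq, dotProduct_smul, smul_eq_mul, hv_def, hv e he, mul_zero]
  have hdiag : e ⬝ᵥ (M₀ *ᵥ e) = bottomRayleigh M₀ * (e ⬝ᵥ e) := by
    rw [heq, dotProduct_smul, smul_eq_mul]
  have hform : u ⬝ᵥ (M₀ *ᵥ u) = v ⬝ᵥ (M₀ *ᵥ v) + bottomRayleigh M₀ * (e ⬝ᵥ e) := by
    rw [hu_dec, form_add_smul_of_isSymm hM₀ v e 1, hcross, hdiag]
    ring
  have hlen : u ⬝ᵥ u = v ⬝ᵥ v + e ⬝ᵥ e := by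
    rw [hu_dec, dotProduct_add_smul_self v e 1, hve]
    ring
  -- (4) the form of `M₀` at `v` from below: the space gap
  have h4 : (bottomRayleigh M₀ + γ) * (v ⬝ᵥ v) ≤ v ⬝ᵥ (M₀ *ᵥ v) := by
    refine hgap' v fun e' he' => ?_
    rw [hv_def]
    exact hv e' he'
  -- (5) compare
  rw [hform, hlen] at h2
  have key : γ * (v ⬝ᵥ v) ≤ 2 * ε * (v ⬝ᵥ v + e ⬝ᵥ e) := by nlinarith [h2, h4]
  refine ⟨e, he, ?_⟩
  rw [← hv_def, hlen, div_mul_eq_mul_div, le_div_iff₀ hγ]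
  linarith

end Summit.RiemannHypothesis.RiemannHypothesis.Theorems.PfPersistence

end
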